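import Summits.Schanuel.Schanuel.Theorems.ZilberEacRamifiedWitness
import Mathlib.Analysis.Calculus.InverseFunctionTheorem.Analytic
import HarnessLib

/-!
# Arbitrary base branches, I: the RAMIFIED WITNESS along an analytic base branch with a
# MEROMORPHIC second coordinate — exact exponential points with every large `k`-th-power label

HONEST FRAMING.  Cell `pub-schanuel` (Zilber's Exponential-Algebraic Closedness, case ladder;
host summit Schanuel), seat 2, gen 28.  Gens 26–27 ran the transcendence method over polynomial
graphs `x₁ = p(x₀)` and polynomially parametrised curves `(g₀(t), g₁(t))`.  Every step used the base
curve only through an analytic branch at infinity; this file isolates the witness step for an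
ARBITRARY such branch: along `x₀ = s^{-k}` (`k ≥ 1`), second additive coordinate `x₁ = Φ(s)·s^{-M}`
(`Φ` analytic at `0` — a meromorphic germ, e.g. a Puiseux expansion at infinity of ANY algebraic
curve), multiplicative coordinate `y₀ = ψ(s) → θ = e^τ ≠ 0`, with the analytic chart `m` of file LVII
(`2πi·m(s)^{-k} = s^{-k} - log(ψ(s)/θ) - τ`).
**`exists_ramified_witness_branch`**: inverting `m` at `μ_j = 1/(m₀ + j)` gives parameters `σ_j → 0`
with `σ_j^{-k} = τ + 2πi(m₀ + j)^k + log(ψ(σ_j)/θ)`, i.e. EXACT exponential points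
`x₀ = σ_j^{-k}`, `e^{x₀} = ψ(σ_j)`, with ALL large `k`-th-power labels, `‖x₀‖ → ∞`,
`‖x₀‖ ≤ ‖τ‖ + 1 + 7(m₀ + j)^k`, the polar form `x₀ = U(μ_j)μ_j^{-k}` (`U` analytic, `U(0) ≠ 0`) and the
EXACT ADDITIVE IDENTITY `Φ(σ_j)σ_j^{-M} = Π(m₀ + j) + r(μ_j)` — `Π ∈ ℂ[X]` of degree `≤ M` (`= M` when
`Φ(0) ≠ 0`), `r` analytic at `0` (the Taylor split of file LVII applied to
`μ ↦ Φ(S(μ))·V(μ)^{-M}`, `S = m⁻¹ = μV`).  An arbitrary germ predicate `G` holding on a punctured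
neighbourhood of `s = 0` is carried to every `σ_j` (in the applications: "the point lies on the
surface").  Also exported, for the algebraic step: on small `s ≠ 0`, `U(m(s))·m(s)^{-k} = s^{-k}` and
`r(m(s)) = Φ(s)s^{-M} - Π(1/m(s))`.
[folklore analysis]; nothing here is specific to Schanuel's conjecture (neither used nor implied);
Mantova–Masser's question (PLMS 2024 §1 p. 5) and EC(3,2) stay OPEN.
-/

noncomputable section

open Filter Topology Polynomial Complex

set_option linter.dupNamespace false

namespace Summit.Schanuel.Schanuel.Theorems

/-- **The ramified witness along an arbitrary analytic base branch.**  See the module docstring.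
[folklore] (new in this form) -/
theorem exists_ramified_witness_branch {ψ : ℂ → ℂ} {θ : ℂ} (hθ0 : θ ≠ 0)
    {τ : ℂ} (hτ : Complex.exp τ = θ) {k : ℕ} (hk : 1 ≤ k)
    {G : ℂ → Prop} (hG : ∀ᶠ s in 𝓝[≠] (0 : ℂ), G s)
    {m : ℂ → ℂ} (hman : AnalyticAt ℂ m 0) (hm0 : m 0 = 0) (hm' : deriv m 0 ≠ 0)
    (hchart : ∀ᶠ s in 𝓝 (0 : ℂ), AnalyticAt ℂ ψ s ∧ ψ s ≠ 0 ∧ ψ s / θ ∈ Complex.slitPlane ∧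
        ‖Complex.log (ψ s / θ)‖ < 1 ∧
        (s ≠ 0 → m s ≠ 0 ∧
          (2 * Real.pi * I) * (m s ^ k)⁻¹ = (s ^ k)⁻¹ - Complex.log (ψ s / θ) - τ))
    {Φ : ℂ → ℂ} (hΦ : AnalyticAt ℂ Φ 0) (M : ℕ) :
    ∃ (U r : ℂ → ℂ) (Pl : ℂ[X]) (m₀ : ℕ) (μ σ : ℕ → ℂ),
      AnalyticAt ℂ U 0 ∧ U 0 ≠ 0 ∧ AnalyticAt ℂ r 0 ∧
      Pl.natDegree ≤ M ∧ (Φ 0 ≠ 0 → Pl.natDegree = M) ∧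
      (∀ᶠ s in 𝓝[≠] (0 : ℂ), U (m s) * (m s)⁻¹ ^ k = (s ^ k)⁻¹ ∧
        r (m s) = Φ s * (s ^ M)⁻¹ - Pl.eval (m s)⁻¹) ∧
      (∀ j, μ j ≠ 0) ∧ Tendsto μ atTop (𝓝 0) ∧
      (∀ j, σ j ≠ 0) ∧ (∀ j, G (σ j)) ∧
      (∀ j, (σ j ^ k)⁻¹ = U (μ j) * (μ j)⁻¹ ^ k) ∧
      (∀ j, Complex.exp ((σ j ^ k)⁻¹) = ψ (σ j)) ∧
      Tendsto (fun j => ‖(σ j ^ k)⁻¹‖) atTop atTop ∧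
      (∀ j, ‖(σ j ^ k)⁻¹‖ ≤ ‖τ‖ + 1 + 7 * (((m₀ + j) ^ k : ℕ) : ℝ)) ∧
      (∀ j, Φ (σ j) * (σ j ^ M)⁻¹ = Pl.eval ((m₀ + j : ℕ) : ℂ) + r (μ j)) := by
  classical
  have hk0 : k ≠ 0 := by omega
  -- the analytic inverse `Sinv` of the chart `m`
  have hstrict : HasStrictDerivAt m (deriv m 0) 0 := hman.hasStrictDerivAt
  have hSan₀ : AnalyticAt ℂ (hstrict.localInverse m _ _ hm') (m 0) := hman.analyticAt_localInverse hm'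
  have hleft : ∀ᶠ s in 𝓝 (0 : ℂ), hstrict.localInverse m _ _ hm' (m s) = s :=
    hstrict.eventually_left_inverse hm'
  have hright₀ : ∀ᶠ μ in 𝓝 (m 0), m (hstrict.localInverse m _ _ hm' μ) = μ :=
    hstrict.eventually_right_inverse hm'
  have hSder₀ : HasStrictDerivAt (hstrict.localInverse m _ _ hm') (deriv m 0)⁻¹ (m 0) :=
    hstrict.to_localInverse hm'
  set Sinv : ℂ → ℂ := hstrict.localInverse m _ _ hm' with hSinv
  rw [hm0] at hSan₀ hright₀ hSder₀
  have hSan : AnalyticAt ℂ Sinv 0 := hSan₀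
  have hS0 : Sinv 0 = 0 := by
    have h := hleft.self_of_nhds
    rwa [hm0] at h
  have hSder : deriv Sinv 0 = (deriv m 0)⁻¹ := hSder₀.hasDerivAt.deriv
  -- `Sinv μ = μ · V μ`, `V` analytic with `V 0 ≠ 0`; `U = V^{-k}`
  set V : ℂ → ℂ := dslope Sinv 0 with hV
  have hVan : AnalyticAt ℂ V 0 := by
    obtain ⟨q, hq⟩ := hSan
    exact ⟨_, hq.has_fpower_series_dslope_fslope⟩
  have hV0 : V 0 ≠ 0 := by
    rw [hV, dslope_same, hSder]
    exact inv_ne_zero hm'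
  have hSV : ∀ μ, Sinv μ = μ * V μ := fun μ => by
    have h := eq_add_mul_dslope Sinv μ
    rwa [hS0, zero_add] at h
  set U : ℂ → ℂ := fun μ => (V μ ^ k)⁻¹ with hU
  have hUan : AnalyticAt ℂ U 0 := (hVan.pow k).inv (pow_ne_zero _ hV0)
  have hU0 : U 0 ≠ 0 := inv_ne_zero (pow_ne_zero _ hV0)
  have hSU : ∀ μ, V μ ≠ 0 → (Sinv μ ^ k)⁻¹ = U μ * μ⁻¹ ^ k := by
    intro μ hVμ
    rw [hSV μ, hU, mul_pow, mul_inv, inv_pow, mul_comm]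
  -- the Laurent split of the phase `Φ(Sinv μ)·(Sinv μ)^{-M} = Gf(μ)·μ^{-M}`, `Gf = (Φ ∘ Sinv)·V^{-M}`
  have hΦS : AnalyticAt ℂ (fun μ => Φ (Sinv μ)) 0 := by
    have hΦ' : AnalyticAt ℂ Φ (Sinv 0) := by rw [hS0]; exact hΦ
    exact hΦ'.comp hSan
  set Gf : ℂ → ℂ := fun μ => Φ (Sinv μ) * (V μ ^ M)⁻¹ with hGf
  have hGfan : AnalyticAt ℂ Gf 0 := hΦS.mul ((hVan.pow M).inv (pow_ne_zero _ hV0))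
  have hGf0 : Gf 0 = Φ 0 * (V 0 ^ M)⁻¹ := by simp [hGf, hS0]
  obtain ⟨Pl, r, hPldeg, hPlc, hran, hlaur⟩ := exists_taylor_split_coeff hGfan M
  have hPlM : Φ 0 ≠ 0 → Pl.natDegree = M := fun hΦ0 => by
    refine Polynomial.natDegree_eq_of_le_of_coeff_ne_zero hPldeg ?_
    rw [hPlc, hGf0]
    exact mul_ne_zero hΦ0 (inv_ne_zero (pow_ne_zero _ hV0))
  have hphase : ∀ μ, μ ≠ 0 → V μ ≠ 0 →
      Φ (Sinv μ) * (Sinv μ ^ M)⁻¹ = Pl.eval μ⁻¹ + r μ := by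
    intro μ hμ hVμ
    have e1 : (Sinv μ ^ M)⁻¹ = μ⁻¹ ^ M * (V μ ^ M)⁻¹ := by
      rw [hSV μ, mul_pow, mul_inv, inv_pow]
    rw [← hlaur μ hμ, e1, hGf]
    ring
  -- facts on small `μ`
  have hScont : Tendsto Sinv (𝓝 0) (𝓝 0) := by
    have h := hSan.continuousAt.tendsto
    rwa [hS0] at h
  have hVne : ∀ᶠ μ in 𝓝 (0 : ℂ), V μ ≠ 0 :=
    (hVan.continuousAt.eventually_ne hV0)
  have hG' : ∀ᶠ s in 𝓝 (0 : ℂ), s ≠ 0 → G s := eventually_nhdsWithin_iff.1 hG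
  have hgood : ∀ᶠ μ in 𝓝 (0 : ℂ), μ ≠ 0 → Sinv μ ≠ 0 ∧ m (Sinv μ) = μ ∧
      (Sinv μ ^ k)⁻¹ = U μ * μ⁻¹ ^ k ∧ G (Sinv μ) ∧
      ψ (Sinv μ) ≠ 0 ∧ ‖Complex.log (ψ (Sinv μ) / θ)‖ < 1 ∧
      (2 * Real.pi * I) * (μ ^ k)⁻¹ = (Sinv μ ^ k)⁻¹ - Complex.log (ψ (Sinv μ) / θ) - τ ∧
      Φ (Sinv μ) * (Sinv μ ^ M)⁻¹ = Pl.eval μ⁻¹ + r μ := by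
    filter_upwards [hright₀, hVne, hScont.eventually hchart, hScont.eventually hG'] with μ hr hVμ hc hb hμ
    have hSμ : Sinv μ ≠ 0 := by rw [hSV μ]; exact mul_ne_zero hμ hVμ
    obtain ⟨-, hψne, -, hlog, hc'⟩ := hc
    obtain ⟨-, hid⟩ := hc' hSμ
    rw [hr] at hid
    exact ⟨hSμ, hr, hSU μ hVμ, hb hSμ, hψne, hlog, hid, hphase μ hμ hVμ⟩
  obtain ⟨δ, hδ, hball⟩ := Metric.eventually_nhds_iff.1 hgood
  -- the labels: `μ_j = 1/(m₀ + j)` with `1/m₀ < δ`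
  obtain ⟨m₀, hm₀⟩ := exists_nat_gt δ⁻¹
  have hm₀pos : 0 < m₀ := Nat.cast_pos.1 (lt_trans (inv_pos.2 hδ) hm₀)
  set μ : ℕ → ℂ := fun j => (((m₀ + j : ℕ) : ℂ))⁻¹ with hμ
  have hlabpos : ∀ j, (0 : ℝ) < ((m₀ + j : ℕ) : ℝ) := fun j => by
    exact_mod_cast Nat.add_pos_left hm₀pos j
  have hμne : ∀ j, μ j ≠ 0 := fun j => by
    rw [hμ]
    exact inv_ne_zero (by exact_mod_cast (Nat.add_pos_left hm₀pos j).ne')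
  have hμnorm : ∀ j, ‖μ j‖ < δ := by
    intro j
    rw [hμ]
    simp only [norm_inv]
    rw [show ‖((m₀ + j : ℕ) : ℂ)‖ = ((m₀ + j : ℕ) : ℝ) by
      rw [← Complex.ofReal_natCast, Complex.norm_real, Real.norm_eq_abs, abs_of_pos (hlabpos j)]]
    calc (((m₀ + j : ℕ) : ℝ))⁻¹ ≤ ((m₀ : ℕ) : ℝ)⁻¹ := by
          refine inv_anti₀ (by exact_mod_cast hm₀pos) ?_
          exact_mod_cast Nat.le_add_right m₀ j
      _ < δ := by
          rw [inv_lt_comm₀ (by exact_mod_cast hm₀pos) hδ]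
          exact hm₀
  have hlab : Tendsto (fun j : ℕ => m₀ + j) atTop atTop :=
    tendsto_atTop_mono (fun j => Nat.le_add_left j m₀) tendsto_id
  have hμlim : Tendsto μ atTop (𝓝 0) :=
    (tendsto_inv_atTop_nhds_zero_nat (𝕜 := ℂ)).comp hlab
  have hfacts : ∀ j, Sinv (μ j) ≠ 0 ∧ m (Sinv (μ j)) = μ j ∧
      (Sinv (μ j) ^ k)⁻¹ = U (μ j) * (μ j)⁻¹ ^ k ∧ G (Sinv (μ j)) ∧
      ψ (Sinv (μ j)) ≠ 0 ∧ ‖Complex.log (ψ (Sinv (μ j)) / θ)‖ < 1 ∧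
      (2 * Real.pi * I) * (μ j ^ k)⁻¹ =
        (Sinv (μ j) ^ k)⁻¹ - Complex.log (ψ (Sinv (μ j)) / θ) - τ ∧
      Φ (Sinv (μ j)) * (Sinv (μ j) ^ M)⁻¹ = Pl.eval (μ j)⁻¹ + r (μ j) := fun j =>
    hball (by rw [dist_zero_right]; exact hμnorm j) (hμne j)
  -- the parameters `σ_j = Sinv(μ_j)` and the points `x₀ = σ_j^{-k}`
  set σ : ℕ → ℂ := fun j => Sinv (μ j) with hσ
  have hμinv : ∀ j, (μ j ^ k)⁻¹ = ((((m₀ + j) ^ k : ℕ)) : ℂ) := fun j => by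
    rw [hμ]; push_cast; rw [inv_pow, inv_inv]
  have hzform : ∀ j, (σ j ^ k)⁻¹ = τ + ((((m₀ + j) ^ k : ℕ)) : ℂ) * (2 * Real.pi * I) +
      Complex.log (ψ (σ j) / θ) := by
    intro j
    obtain ⟨-, -, -, -, -, -, hid, -⟩ := hfacts j
    rw [← hμinv j]
    linear_combination -hid
  have hexpz : ∀ j, Complex.exp ((σ j ^ k)⁻¹) = ψ (σ j) := by
    intro j
    obtain ⟨-, -, -, -, hψne, -, -, -⟩ := hfacts j
    rw [hzform j, Complex.exp_add, Complex.exp_add, hτ, Complex.exp_nat_mul_two_pi_mul_I, mul_one,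
      Complex.exp_log (div_ne_zero hψne hθ0), mul_div_cancel₀ _ hθ0]
  have hnorm2π := norm_two_pi_I_lt_seven
  have hzup : ∀ j, ‖(σ j ^ k)⁻¹‖ ≤ ‖τ‖ + 1 + 7 * (((m₀ + j) ^ k : ℕ) : ℝ) := by
    intro j
    obtain ⟨-, -, -, -, -, hlog, -, -⟩ := hfacts j
    rw [hzform j]
    have hK : (0 : ℝ) ≤ (((m₀ + j) ^ k : ℕ) : ℝ) := Nat.cast_nonneg _
    refine (norm_add_le _ _).trans ((add_le_add (norm_add_le _ _) hlog.le).trans ?_)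
    rw [norm_mul, Complex.norm_natCast]
    nlinarith
  have hzlow : ∀ j, 6 * ((m₀ + j : ℕ) : ℝ) - (‖τ‖ + 1) ≤ ‖(σ j ^ k)⁻¹‖ := by
    intro j
    obtain ⟨-, -, -, -, -, hlog, -, -⟩ := hfacts j
    have hK : ((m₀ + j : ℕ) : ℝ) ≤ (((m₀ + j) ^ k : ℕ) : ℝ) := by
      exact_mod_cast Nat.le_self_pow hk0 (m₀ + j)
    have h2π : (6 : ℝ) ≤ ‖(2 * Real.pi * I : ℂ)‖ := by
      rw [show (2 * Real.pi * I : ℂ) = ((2 * Real.pi : ℝ) : ℂ) * I by push_cast; ring, norm_mul,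
        Complex.norm_I, mul_one, Complex.norm_real, Real.norm_eq_abs, abs_of_pos Real.two_pi_pos]
      have := Real.pi_gt_three
      linarith
    have hmain : ‖((((m₀ + j) ^ k : ℕ)) : ℂ) * (2 * Real.pi * I)‖ -
        ‖τ + Complex.log (ψ (σ j) / θ)‖ ≤ ‖(σ j ^ k)⁻¹‖ := by
      rw [hzform j, show τ + ((((m₀ + j) ^ k : ℕ)) : ℂ) * (2 * Real.pi * I) +
        Complex.log (ψ (σ j) / θ) = ((((m₀ + j) ^ k : ℕ)) : ℂ) * (2 * Real.pi * I) +
        (τ + Complex.log (ψ (σ j) / θ)) by ring]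
      exact norm_sub_le_norm_add _ _
    rw [norm_mul, Complex.norm_natCast] at hmain
    have h3 : ‖τ + Complex.log (ψ (σ j) / θ)‖ ≤ ‖τ‖ + 1 :=
      (norm_add_le _ _).trans (by linarith)
    have hK0 : (0 : ℝ) ≤ ((m₀ + j : ℕ) : ℝ) := Nat.cast_nonneg _
    nlinarith
  have hznorm : Tendsto (fun j => ‖(σ j ^ k)⁻¹‖) atTop atTop := by
    refine Literature.ModelTheory.Zilber.tendsto_norm_atTop_of_le
      (K := fun j => ((m₀ + j : ℕ) : ℝ)) ?_ (a := 6) (b := ‖τ‖ + 1) (by norm_num) hzlow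
    exact tendsto_natCast_atTop_atTop.comp hlab
  refine ⟨U, r, Pl, m₀, μ, σ, hUan, hU0, hran, hPldeg, hPlM, ?_, hμne, hμlim,
    fun j => (hfacts j).1, fun j => (hfacts j).2.2.2.1, fun j => (hfacts j).2.2.1, hexpz, hznorm,
    hzup, fun j => ?_⟩
  · -- the identities along `μ = m(s)`
    have hmcont : Tendsto m (𝓝 0) (𝓝 0) := by
      have h := hman.continuousAt.tendsto
      rwa [hm0] at h
    have hev : ∀ᶠ s in 𝓝 (0 : ℂ), s ≠ 0 → U (m s) * (m s)⁻¹ ^ k = (s ^ k)⁻¹ ∧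
        r (m s) = Φ s * (s ^ M)⁻¹ - Pl.eval (m s)⁻¹ := by
      filter_upwards [hleft, hchart, hmcont.eventually hgood] with s hl hc hg hs
      obtain ⟨hms, -⟩ := hc.2.2.2.2 hs
      obtain ⟨-, -, hSU', -, -, -, -, hph⟩ := hg hms
      rw [hl] at hSU' hph
      refine ⟨hSU'.symm, ?_⟩
      linear_combination -hph
    exact eventually_nhdsWithin_iff.2 hev
  · have h := (hfacts j).2.2.2.2.2.2.2
    rw [h, hμ, inv_inv]

end Summit.Schanuel.Schanuel.Theorems
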